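import Summits.HubbardSuperconductivity.HubbardSuperconductivity.Theses.BcsKacWindow
import Summits.HubbardSuperconductivity.HubbardSuperconductivity.Theorems.BcsKacWindowShellMultiplicityBoundMann

/-!
# Route `BcsKacWindow`, crux `ShellMultiplicityBound` (item `stmt-HubbardSuperconductivity-1325`):
# uniform multiplicity of the square-lattice Fermi shells (file 3/3, closes the item)

`ShellMultiplicityBound`: there is `M₀` such that for every `L` and every `E ≠ 0` the torus shell
`#{(a,b) ∈ (ℤ/L)² : cos(2πa/L) + cos(2πb/L) = E}` has at most `M₀` elements. We prove it with
`M₀ = 1260²`.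

Proof. Fix one solution `(a₀,b₀)` and put `x = ζ^{a₀}`, `y = ζ^{b₀}` (`ζ = e^{2πi/L}`); any solution
`(c,d)` gives roots of unity `u = ζ^c`, `v = ζ^d` with the vanishing 8-term sum
`x + x⁻¹ + y + y⁻¹ - u - u⁻¹ - v - v⁻¹ = 0`. By Mann's theorem (file 2/3) the term `-u` lies in a
vanishing sub-block with at least one other term, all of whose ratios are `210`-th roots of unity
(`210 = primorial 8`). If the block meets a known term, `u^{210} ∈ {x^{±210}, y^{±210}}`; if it
contains `u⁻¹`, or both `v, v⁻¹`, then `u^{420} = 1`; the remaining blocks `{-u,-v}`, `{-u,-v⁻¹}`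
force `u + u⁻¹ + v + v⁻¹ = 0`, i.e. `E = 0`, which is excluded (`admissible_of_relation`). Hence `c`
ranges over at most `420 + 4·210 = 1260` residues (`c ↦ ζ^c` is injective on `Fin L` and `X^m = a`
has at most `m` roots), and symmetrically for `d`.

References: H. B. Mann, Mathematika 12 (1965) 107–117; J. H. Conway, A. J. Jones, *Trigonometric
diophantine equations (On vanishing sums of roots of unity)*, Acta Arith. 30 (1976) 229–240, §2 and
Thm 7 (where the sharp classification of `cos α + cos β = cos γ + cos δ` is obtained).
-/

set_option linter.dupNamespace false

namespace Summit.HubbardSuperconductivity.HubbardSuperconductivity.Theorems.BcsKacWindow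

open Finset Polynomial

/-- `primorial 8 = 2 · 3 · 5 · 7 = 210`. -/
theorem primorial_eight : primorial 8 = 210 := by decide

/-- **The 8-term analysis.** If `x, y, u, v` are roots of unity with
`x + x⁻¹ + y + y⁻¹ = u + u⁻¹ + v + v⁻¹ ≠ 0`, then `u ^ 420 = 1` or `u ^ 210 = t ^ 210` for some
`t ∈ {x, x⁻¹, y, y⁻¹}`. -/
theorem admissible_of_relation {L : ℕ} (hL : 0 < L) {x y u v : ℂ} (hx : x ^ L = 1) (hy : y ^ L = 1)
    (hu : u ^ L = 1) (hv : v ^ L = 1) (hrel : x + x⁻¹ + y + y⁻¹ = u + u⁻¹ + v + v⁻¹)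
    (hE : x + x⁻¹ + y + y⁻¹ ≠ 0) :
    u ^ 420 = 1 ∨ ∃ t ∈ ({x, x⁻¹, y, y⁻¹} : Finset ℂ), u ^ 210 = t ^ 210 := by
  classical
  -- the vanishing sum, indexed by `Fin 8`
  set t : Fin 8 → ℂ := ![x, x⁻¹, y, y⁻¹, u, u⁻¹, v, v⁻¹] with ht_def
  set ε : Fin 8 → ℚ := ![1, 1, 1, 1, -1, -1, -1, -1] with hε_def
  have hε : ∀ i ∈ (univ : Finset (Fin 8)), ε i ≠ 0 := by
    intro i _
    fin_cases i <;> simp [hε_def]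
  have hroot : ∀ i ∈ (univ : Finset (Fin 8)), ∃ N : ℕ, 0 < N ∧ t i ^ N = 1 := by
    intro i _
    refine ⟨L, hL, ?_⟩
    fin_cases i <;> simp [ht_def, hx, hy, hu, hv]
  have hsum : ∑ i ∈ (univ : Finset (Fin 8)), (ε i : ℂ) * t i = 0 := by
    rw [Fin.sum_univ_eight]
    simp only [ht_def, hε_def, Matrix.cons_val_zero, Matrix.cons_val_one,
      Matrix.cons_val, Rat.cast_one, Rat.cast_neg, one_mul, neg_one_mul]
    linear_combination hrel
  have ht0 : ∀ i, t i ≠ 0 := by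
    intro i h0
    obtain ⟨N, hN, hN1⟩ := hroot i (mem_univ i)
    rw [h0, zero_pow hN.ne'] at hN1
    exact zero_ne_one hN1
  obtain ⟨B, -, h4B, hBsum, ⟨j₁, hj₁B, hj₁⟩, hratio⟩ :=
    exists_block_ratio_pow_primorial_eq_one univ ε t hε hroot hsum (mem_univ 4)
  rw [card_univ, Fintype.card_fin, primorial_eight] at hratio
  -- ratio facts in usable form: `t j ^ 210 = t k ^ 210`
  have hpow : ∀ j ∈ B, ∀ k ∈ B, t j ^ 210 = t k ^ 210 := by
    intro j hj k hk
    have h := hratio j hj k hk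
    rw [div_pow, div_eq_one_iff_eq (pow_ne_zero _ (ht0 k))] at h
    exact h
  by_cases hknown : ∃ j ∈ B, (j : ℕ) < 4
  · -- the block meets a known term
    obtain ⟨j, hjB, hj⟩ := hknown
    right
    refine ⟨t j, ?_, by simpa [ht_def] using hpow 4 h4B j hjB⟩
    have hj' : j = 0 ∨ j = 1 ∨ j = 2 ∨ j = 3 := by
      fin_cases j <;> simp at hj ⊢
    rcases hj' with rfl | rfl | rfl | rfl <;> simp [ht_def]
  · left
    have hge : ∀ j ∈ B, 4 ≤ (j : ℕ) := fun j hj => by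
      by_contra h
      exact hknown ⟨j, hj, by omega⟩
    by_cases h5 : (5 : Fin 8) ∈ B
    · -- `u / u⁻¹ = u²` is a `210`-th root of unity
      have h := hpow 4 h4B 5 h5
      simp only [ht_def, Matrix.cons_val] at h
      have hu0 : u ≠ 0 := by simpa [ht_def] using ht0 4
      rw [inv_pow] at h
      rw [← (mul_eq_one_iff_eq_inv₀ (pow_ne_zero _ hu0)).mpr h, ← pow_add]
    · by_cases h67 : (6 : Fin 8) ∈ B ∧ (7 : Fin 8) ∈ B
      · -- `v² ∈ μ₂₁₀` and `u/v ∈ μ₂₁₀`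
        have h1 := hpow 6 h67.1 7 h67.2
        have h2 := hpow 4 h4B 6 h67.1
        simp only [ht_def, Matrix.cons_val] at h1 h2
        have hv0 : v ≠ 0 := by simpa [ht_def] using ht0 6
        rw [inv_pow] at h1
        have h1' : v ^ 210 * v ^ 210 = 1 := (mul_eq_one_iff_eq_inv₀ (pow_ne_zero _ hv0)).mpr h1
        calc u ^ 420 = u ^ 210 * u ^ 210 := by ring
          _ = v ^ 210 * v ^ 210 := by rw [h2]
          _ = 1 := h1'
      · -- the bad blocks `{-u, -v}` and `{-u, -v⁻¹}` force `E = 0`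
        exfalso
        have hj₁' : j₁ = 6 ∨ j₁ = 7 := by
          have h4 := hge j₁ hj₁B
          have : j₁ ≠ 5 := fun h => h5 (h ▸ hj₁B)
          fin_cases j₁ <;> simp_all
        -- membership table of `B`
        have h0 : (0 : Fin 8) ∉ B := fun h => by have := hge 0 h; simp at this
        have h1 : (1 : Fin 8) ∉ B := fun h => by have := hge 1 h; simp at this
        have h2 : (2 : Fin 8) ∉ B := fun h => by have := hge 2 h; simp at this
        have h3 : (3 : Fin 8) ∉ B := fun h => by have := hge 3 h; simp at this
        have hsumB : ∑ k ∈ B, (ε k : ℂ) * t k =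
            ∑ k : Fin 8, if k ∈ B then (ε k : ℂ) * t k else 0 := by
          rw [← sum_filter, filter_mem_eq_inter, univ_inter]
        rw [hsumB, Fin.sum_univ_eight] at hBsum
        have huv : u + u⁻¹ + v + v⁻¹ = 0 := by
          have hu0 : u ≠ 0 := by simpa [ht_def] using ht0 4
          have hv0 : v ≠ 0 := by simpa [ht_def] using ht0 6
          rcases hj₁' with rfl | rfl
          · have h7 : (7 : Fin 8) ∉ B := fun h => h67 ⟨hj₁B, h⟩
            simp only [h0, h1, h2, h3, h4B, h5, hj₁B, h7, if_true, if_false, ht_def, hε_def,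
              Matrix.cons_val, Rat.cast_one, Rat.cast_neg, zero_add, add_zero] at hBsum
            -- `hBsum : -u - v = 0`
            have hvu : v = -u := by linear_combination -hBsum
            rw [hvu, inv_neg]
            ring
          · have h6 : (6 : Fin 8) ∉ B := fun h => h67 ⟨h, hj₁B⟩
            simp only [h0, h1, h2, h3, h4B, h5, hj₁B, h6, if_true, if_false, ht_def, hε_def,
              Matrix.cons_val, Rat.cast_one, Rat.cast_neg, zero_add, add_zero] at hBsum
            -- `hBsum : -u - v⁻¹ = 0`
            have hvu : v⁻¹ = -u := by linear_combination -hBsum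
            have hvu' : v = -u⁻¹ := by
              rw [← inv_inv v, hvu, inv_neg]
            rw [hvu', inv_neg, inv_inv]
            ring
        exact hE (hrel.trans huv)

/-- At most `m` residues `c ∈ ℤ/L` have `(ζ^c)^m = a` (`ζ` a primitive `L`-th root, `0 < m`):
`c ↦ ζ^c` is injective on `Fin L` and `X^m - a` has at most `m` roots. -/
theorem card_filter_pow_pow_eq_le {L : ℕ} {ζ : ℂ} (hζ : IsPrimitiveRoot ζ L) {m : ℕ} (hm : 0 < m)
    (a : ℂ) [DecidablePred fun c : Fin L => (ζ ^ (c : ℕ)) ^ m = a] :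
    (univ.filter (fun c : Fin L => (ζ ^ (c : ℕ)) ^ m = a)).card ≤ m := by
  classical
  have hinj : Function.Injective (fun c : Fin L => ζ ^ (c : ℕ)) := by
    intro c₁ c₂ h
    exact Fin.ext (hζ.pow_inj c₁.2 c₂.2 h)
  rw [← card_image_of_injective _ hinj]
  calc ((univ.filter (fun c : Fin L => (ζ ^ (c : ℕ)) ^ m = a)).image
        (fun c : Fin L => ζ ^ (c : ℕ))).card
      ≤ (nthRoots m a).toFinset.card := by
        apply card_le_card
        intro z hz
        rw [mem_image] at hz
        obtain ⟨c, hc, rfl⟩ := hz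
        rw [mem_filter] at hc
        rw [Multiset.mem_toFinset, mem_nthRoots hm]
        exact hc.2
    _ ≤ Multiset.card (nthRoots m a) := Multiset.toFinset_card_le _
    _ ≤ m := card_nthRoots m a

/-- The admissible residues for one coordinate number at most `1260 = 420 + 4 · 210`. -/
theorem card_filter_admissible_le {L : ℕ} {ζ : ℂ} (hζ : IsPrimitiveRoot ζ L) (T : Finset ℂ)
    (hT : T.card ≤ 4)
    [DecidablePred fun c : Fin L =>
      (ζ ^ (c : ℕ)) ^ 420 = 1 ∨ ∃ t ∈ T, (ζ ^ (c : ℕ)) ^ 210 = t ^ 210] :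
    (univ.filter (fun c : Fin L =>
      (ζ ^ (c : ℕ)) ^ 420 = 1 ∨ ∃ t ∈ T, (ζ ^ (c : ℕ)) ^ 210 = t ^ 210)).card ≤ 1260 := by
  classical
  have hsub : univ.filter (fun c : Fin L =>
        (ζ ^ (c : ℕ)) ^ 420 = 1 ∨ ∃ t ∈ T, (ζ ^ (c : ℕ)) ^ 210 = t ^ 210) ⊆
      univ.filter (fun c : Fin L => (ζ ^ (c : ℕ)) ^ 420 = 1) ∪
        T.biUnion (fun t => univ.filter (fun c : Fin L => (ζ ^ (c : ℕ)) ^ 210 = t ^ 210)) := by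
    intro c hc
    rw [mem_filter] at hc
    rw [mem_union, mem_filter, mem_biUnion]
    rcases hc.2 with h | ⟨t, ht, h⟩
    · exact Or.inl ⟨mem_univ _, h⟩
    · exact Or.inr ⟨t, ht, mem_filter.mpr ⟨mem_univ _, h⟩⟩
  calc _ ≤ _ := card_le_card hsub
    _ ≤ (univ.filter (fun c : Fin L => (ζ ^ (c : ℕ)) ^ 420 = 1)).card +
        (T.biUnion (fun t => univ.filter (fun c : Fin L => (ζ ^ (c : ℕ)) ^ 210 = t ^ 210))).card :=
          card_union_le _ _
    _ ≤ 420 + ∑ t ∈ T, (univ.filter (fun c : Fin L => (ζ ^ (c : ℕ)) ^ 210 = t ^ 210)).card :=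
          Nat.add_le_add (card_filter_pow_pow_eq_le hζ (by norm_num) 1) card_biUnion_le
    _ ≤ 420 + ∑ _t ∈ T, 210 :=
          Nat.add_le_add_left (sum_le_sum fun t _ => card_filter_pow_pow_eq_le hζ (by norm_num) _) _
    _ ≤ 420 + 4 * 210 := by
          rw [sum_const, smul_eq_mul]
          exact Nat.add_le_add_left (Nat.mul_le_mul_right _ hT) _
    _ = 1260 := by norm_num

/-- The shell equation in multiplicative form: with `ζ = e^{2πi/L}`,
`cos(2πa/L) + cos(2πb/L) = E` reads `ζ^a + ζ^{-a} + ζ^b + ζ^{-b} = 2E`. -/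
theorem cos_add_cos_eq_iff {L : ℕ} (hL : 0 < L) (a b : ℕ) (E : ℝ) :
    Real.cos (2 * Real.pi * a / L) + Real.cos (2 * Real.pi * b / L) = E ↔
      Complex.exp (2 * Real.pi * Complex.I / L) ^ a +
          (Complex.exp (2 * Real.pi * Complex.I / L) ^ a)⁻¹
        + Complex.exp (2 * Real.pi * Complex.I / L) ^ b
        + (Complex.exp (2 * Real.pi * Complex.I / L) ^ b)⁻¹ = 2 * (E : ℂ) := by
  have hL' : (L : ℂ) ≠ 0 := Nat.cast_ne_zero.mpr hL.ne'
  have key : ∀ c : ℕ, ((Real.cos (2 * Real.pi * c / L) : ℝ) : ℂ) =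
      (Complex.exp (2 * Real.pi * Complex.I / L) ^ c +
        (Complex.exp (2 * Real.pi * Complex.I / L) ^ c)⁻¹) / 2 := by
    intro c
    rw [Complex.ofReal_cos, ← Complex.exp_nat_mul, ← Complex.exp_neg]
    have h2 : (2 : ℂ) ≠ 0 := two_ne_zero
    rw [eq_div_iff h2, mul_comm, Complex.two_cos]
    congr 1
    · congr 1
      push_cast
      field_simp
    · congr 1
      push_cast
      field_simp
  constructor
  · intro h
    have h' := congr_arg (fun r : ℝ => ((r : ℝ) : ℂ)) h
    simp only [Complex.ofReal_add, key] at h'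
    linear_combination 2 * h'
  · intro h
    apply Complex.ofReal_injective
    rw [Complex.ofReal_add, key, key]
    linear_combination h / 2

/-- **The shell count.** For `0 < L`, `E ≠ 0` and any set `F` of solutions of
`cos(2πa/L) + cos(2πb/L) = E` in `Fin L × Fin L`, `|F| ≤ 1260²`. -/
theorem card_shell_le {L : ℕ} (hL : 0 < L) {E : ℝ} (hE : E ≠ 0) (F : Finset (Fin L × Fin L))
    (hF : ∀ q ∈ F,
      Real.cos (2 * Real.pi * (q.1 : ℕ) / L) + Real.cos (2 * Real.pi * (q.2 : ℕ) / L) = E) :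
    F.card ≤ 1260 * 1260 := by
  classical
  rcases F.eq_empty_or_nonempty with hF0 | ⟨⟨a₀, b₀⟩, hab₀⟩
  · simp [hF0]
  have hζ := Complex.isPrimitiveRoot_exp L hL.ne'
  have hcos := fun a b : ℕ => cos_add_cos_eq_iff hL a b E
  generalize Complex.exp (2 * Real.pi * Complex.I / L) = ζ at hζ hcos
  -- the fixed solution `x = ζ^{a₀}`, `y = ζ^{b₀}`
  have hxy : ζ ^ (a₀ : ℕ) + (ζ ^ (a₀ : ℕ))⁻¹ + ζ ^ (b₀ : ℕ) + (ζ ^ (b₀ : ℕ))⁻¹ = 2 * (E : ℂ) := by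
    have h := hF _ hab₀
    exact (hcos a₀ b₀).mp h
  have hE' : ζ ^ (a₀ : ℕ) + (ζ ^ (a₀ : ℕ))⁻¹ + ζ ^ (b₀ : ℕ) + (ζ ^ (b₀ : ℕ))⁻¹ ≠ 0 := by
    rw [hxy]
    exact mul_ne_zero two_ne_zero (Complex.ofReal_ne_zero.mpr hE)
  have hpowL : ∀ c : ℕ, (ζ ^ c) ^ L = 1 := fun c => by
    rw [← pow_mul, mul_comm, pow_mul, hζ.pow_eq_one, one_pow]
  have hT : ({ζ ^ (a₀ : ℕ), (ζ ^ (a₀ : ℕ))⁻¹, ζ ^ (b₀ : ℕ), (ζ ^ (b₀ : ℕ))⁻¹} : Finset ℂ).card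
      ≤ 4 := by
    refine (card_insert_le _ _).trans ?_
    refine (Nat.succ_le_succ (card_insert_le _ _)).trans ?_
    refine (Nat.succ_le_succ (Nat.succ_le_succ (card_insert_le _ _))).trans ?_
    rw [card_singleton]
  have hkey : ∀ q ∈ F,
      ((ζ ^ (q.1 : ℕ)) ^ 420 = 1 ∨
        ∃ t ∈ ({ζ ^ (a₀ : ℕ), (ζ ^ (a₀ : ℕ))⁻¹, ζ ^ (b₀ : ℕ), (ζ ^ (b₀ : ℕ))⁻¹} : Finset ℂ),
          (ζ ^ (q.1 : ℕ)) ^ 210 = t ^ 210) ∧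
      ((ζ ^ (q.2 : ℕ)) ^ 420 = 1 ∨
        ∃ t ∈ ({ζ ^ (a₀ : ℕ), (ζ ^ (a₀ : ℕ))⁻¹, ζ ^ (b₀ : ℕ), (ζ ^ (b₀ : ℕ))⁻¹} : Finset ℂ),
          (ζ ^ (q.2 : ℕ)) ^ 210 = t ^ 210) := by
    rintro ⟨c, d⟩ hcd
    have huv : ζ ^ (c : ℕ) + (ζ ^ (c : ℕ))⁻¹ + ζ ^ (d : ℕ) + (ζ ^ (d : ℕ))⁻¹ = 2 * (E : ℂ) := by
      have h := hF _ hcd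
      exact (hcos c d).mp h
    constructor
    · exact admissible_of_relation hL (hpowL a₀) (hpowL b₀) (hpowL c) (hpowL d)
        (hxy.trans huv.symm) hE'
    · refine admissible_of_relation hL (hpowL a₀) (hpowL b₀) (hpowL d) (hpowL c)
        (hxy.trans ?_) hE'
      rw [← huv]
      ring
  have hsub : F ⊆
      (univ.filter (fun c : Fin L => (ζ ^ (c : ℕ)) ^ 420 = 1 ∨
        ∃ t ∈ ({ζ ^ (a₀ : ℕ), (ζ ^ (a₀ : ℕ))⁻¹, ζ ^ (b₀ : ℕ), (ζ ^ (b₀ : ℕ))⁻¹} : Finset ℂ),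
          (ζ ^ (c : ℕ)) ^ 210 = t ^ 210)) ×ˢ
      (univ.filter (fun c : Fin L => (ζ ^ (c : ℕ)) ^ 420 = 1 ∨
        ∃ t ∈ ({ζ ^ (a₀ : ℕ), (ζ ^ (a₀ : ℕ))⁻¹, ζ ^ (b₀ : ℕ), (ζ ^ (b₀ : ℕ))⁻¹} : Finset ℂ),
          (ζ ^ (c : ℕ)) ^ 210 = t ^ 210)) := by
    intro q hq
    rw [mem_product, mem_filter, mem_filter]
    exact ⟨⟨mem_univ _, (hkey q hq).1⟩, ⟨mem_univ _, (hkey q hq).2⟩⟩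
  have hcardAdm := card_filter_admissible_le hζ _ hT
  calc F.card ≤ _ := card_le_card hsub
    _ = _ := card_product _ _
    _ ≤ 1260 * 1260 := Nat.mul_le_mul hcardAdm hcardAdm

open Summit.HubbardSuperconductivity.HubbardSuperconductivity.Theses.BcsKacWindow in
/-- **`ShellMultiplicityBound` (item `stmt-HubbardSuperconductivity-1325`).** The Fermi shells of
the square-lattice torus away from the nested level `E = 0` are uniformly bounded:
`#{(a,b) ∈ (ℤ/L)² : cos(2πa/L) + cos(2πb/L) = E} ≤ 1260²` for all `L` and all `E ≠ 0`. -/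
theorem shellMultiplicityBound_proof : ShellMultiplicityBound := by
  unfold ShellMultiplicityBound
  refine ⟨1260 * 1260, fun L E hE => ?_⟩
  rcases Nat.eq_zero_or_pos L with hL0 | hL
  · subst hL0
    exact (card_le_univ _).trans (by simp)
  · exact card_shell_le hL hE _ fun q hq => (mem_filter.mp hq).2

end Summit.HubbardSuperconductivity.HubbardSuperconductivity.Theorems.BcsKacWindow
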